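import Mathlib
import HarnessLib
import Summits.NavierStokesRegularity.NavierStokesRegularity.Theorems.PoloidalWindowDoorLrcModEntireJetCertGauge
import Summits.NavierStokesRegularity.NavierStokesRegularity.Theorems.PoloidalWindowDoorLrcModEntireJetCertCancel

/-!
# Route `PoloidalWindowDoor`, item `LrcModEntire` (stmt-NavierStokesRegularity-20428) — certificate checker: CANCELLATION STEPS for local data with
# point-zero letters (pseudo-division by pin monomials; gauged Thomas-style chains)

Cell ns-regularity-ideate, seat ns-poloidal-K2-p3 gen 8 (LEAD of item 20428; `--supports stmt-NavierStokesRegularity-20428`).  Complement of `…JetCertGauge`: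
an engine that pseudo-divides by a pivot (a monomial in the pins `twist, μ, μ−1, μ_z, Π_NU`) certifies a law `(Π pinsᵉ)·P`; here `P` joins the hypotheses of
a `LocalDatumZ` (same base point — the point-zero letters survive, unlike under `split`).  With `LocalDatumZ.extendS` (plain chunk), `LocalDatumZ.cancelS`
(this file) and the gauged leaf `LocalDatumZ.false_of_leaf` every SPLIT-FREE Ritt–Thomas chain in the Galilean gauge is checkable: `gaugedChainCheck` folds a
list of chunk / cancel items and a final gauged leaf; `LocalDatumZ.false_of_gaugedChain` is its soundness.  WHAT THIS IS NOT: not a claim about Navier–Stokes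
and not a certificate. [folklore]
-/

noncomputable section

-- the summit and its single sub-problem share the name (CONVENTIONS §1), as in every Theorems file
set_option linter.dupNamespace false

namespace Summit.NavierStokesRegularity.NavierStokesRegularity.Theorems.PoloidalWindowDoorLrcModEntireJetCertGaugeCancel

open _root_.Topology _root_.Filter Set
open Literature.Analysis.ValidatedNumerics Literature.Analysis.ValidatedNumerics.QMvPoly
open Literature.Analysis.Calculus.MvPoly
open Summit.NavierStokesRegularity.NavierStokesRegularity.Theorems.PoloidalWindowDoorLrcModEntireJetCertDefs
open Summit.NavierStokesRegularity.NavierStokesRegularity.Theorems.PoloidalWindowDoorLrcModEntireJetCertMasked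
open Summit.NavierStokesRegularity.NavierStokesRegularity.Theorems.PoloidalWindowDoorLrcModEntireJetCertTree
open Summit.NavierStokesRegularity.NavierStokesRegularity.Theorems.PoloidalWindowDoorLrcModEntireJetCertFast2
open Summit.NavierStokesRegularity.NavierStokesRegularity.Theorems.PoloidalWindowDoorLrcModEntireJetCertCancel
open Summit.NavierStokesRegularity.NavierStokesRegularity.Theorems.PoloidalWindowDoorLrcModEntireJetCertGauge

variable {E : Type*} [NormedAddCommGroup E] [NormedSpace ℝ E] {n : ℕ}

/-- **CANCELLATION with point-zero letters**: a derivation certifying `(Π pinsᵉ)·P` from the hypotheses makes `P` a hypothesis law of a `LocalDatumZ` with the same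
tables, pins, base point and point-zero letters (on the open neighbourhood of the base point where the pin monomial does not vanish). [folklore] -/
theorem LocalDatumZ.cancelS {S : ℕ → ℕ → QMvPoly} {M : ℕ → ℕ → Bool} {v : ℕ → E} {hyps pins : List QMvPoly} {zs : List ℕ}
    (hdat : LocalDatumZ (E := E) n S M v hyps pins zs) {cert : List (List (QMvPoly × ℕ × List ℕ))} {k : ℕ} {e : List ℕ} {P : QMvPoly}
    (hcheck : certCheckS n S M hyps cert k (QMvPoly.mul (pinProduct pins e) P) = true) :
    LocalDatumZ (E := E) n S M v (hyps ++ [P]) pins zs := by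
  obtain ⟨U, p₀, g, hU, hp₀, hg, hS, hhyps, hpins, hz⟩ := hdat
  have hprod : ∀ x ∈ U, ev n (pinProduct pins e) (g x) * ev n P (g x) = 0 := by
    intro x hx
    rw [← ev_mul]
    exact ev_eq_zero_of_certCheckS hU hg hS hhyps hcheck x hx
  have hne : ev n (pinProduct pins e) (g p₀) ≠ 0 := ev_pinProduct_ne_zero (g p₀) pins e hpins
  have hev : ∀ᶠ x in 𝓝 p₀, ev n (pinProduct pins e) (g x) ≠ 0 :=
    (continuousAt_ev_comp (hg p₀ hp₀) (pinProduct pins e)).eventually_ne hne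
  obtain ⟨V, hVsub, hVo, hp₀V⟩ := mem_nhds_iff.1 hev
  refine ⟨U ∩ V, p₀, g, hU.inter hVo, ⟨hp₀, hp₀V⟩, fun x hx => hg x hx.1, fun j i hi x hx => hS j i hi x hx.1, ?_, hpins, hz⟩
  intro L hL x hx
  rcases List.mem_append.1 hL with h | h
  · exact hhyps L h x hx.1
  · rw [List.mem_singleton.1 h]
    have h1 := hprod x hx.1
    have h2 : ev n (pinProduct pins e) (g x) ≠ 0 := hVsub hx.2
    rcases mul_eq_zero.1 h1 with h0 | h0
    · exact absurd h0 h2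
    · exact h0

/-! ### Split-free gauged chains -/

/-- One item of a split-free chain: a plain chunk (certified law `T`) or a cancellation (certified `pins^e · P`, continue with `P`). [folklore] -/
inductive ChainItem : Type
  | chunk (cert : List (List (QMvPoly × ℕ × List ℕ))) (k : ℕ) (T : QMvPoly)
  | cancel (cert : List (List (QMvPoly × ℕ × List ℕ))) (k : ℕ) (e : List ℕ) (P : QMvPoly)

/-- The law an item appends to the hypotheses. [folklore] -/
def ChainItem.law : ChainItem → QMvPoly
  | .chunk _ _ T => T
  | .cancel _ _ _ P => P

/-- The Boolean check of one item against the current hypotheses. [folklore] -/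
def ChainItem.check (n : ℕ) (S : ℕ → ℕ → QMvPoly) (M : ℕ → ℕ → Bool) (hyps pins : List QMvPoly) : ChainItem → Bool
  | .chunk cert k T => certCheckS n S M hyps cert k T
  | .cancel cert k e P => certCheckS n S M hyps cert k (QMvPoly.mul (pinProduct pins e) P)

/-- **THE GAUGED CHAIN CHECK**: fold the items (each against the hypotheses extended by the earlier items' laws), then the gauged leaf. [folklore] -/
def gaugedChainCheck (n : ℕ) (S : ℕ → ℕ → QMvPoly) (M : ℕ → ℕ → Bool) (pins : List QMvPoly) (zs : List ℕ) :
    List QMvPoly → List ChainItem → List (List (QMvPoly × ℕ × List ℕ)) → ℕ → List ℕ → Bool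
  | hyps, [], steps, k, e => leafCheckZ n S M hyps pins zs steps k e
  | hyps, it :: items, steps, k, e => it.check n S M hyps pins && gaugedChainCheck n S M pins zs (hyps ++ [it.law]) items steps k e

/-- **SOUNDNESS OF SPLIT-FREE GAUGED CHAINS.** [folklore] -/
theorem LocalDatumZ.false_of_gaugedChain {S : ℕ → ℕ → QMvPoly} {M : ℕ → ℕ → Bool} {v : ℕ → E} {pins : List QMvPoly} {zs : List ℕ} :
    ∀ (items : List ChainItem) (hyps : List QMvPoly) (steps : List (List (QMvPoly × ℕ × List ℕ))) (k : ℕ) (e : List ℕ),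
      gaugedChainCheck n S M pins zs hyps items steps k e = true → LocalDatumZ (E := E) n S M v hyps pins zs → False := by
  intro items
  induction items with
  | nil =>
    intro hyps steps k e hc hdat
    exact LocalDatumZ.false_of_leaf hdat (by simpa [gaugedChainCheck] using hc)
  | cons it items ih =>
    intro hyps steps k e hc hdat
    simp only [gaugedChainCheck, Bool.and_eq_true] at hc
    obtain ⟨h1, h2⟩ := hc
    cases it with
    | chunk cert k' T =>
      exact ih (hyps ++ [T]) steps k e h2 (LocalDatumZ.extendS hdat (by simpa [ChainItem.check] using h1))
    | cancel cert k' e' P =>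
      exact ih (hyps ++ [P]) steps k e h2 (LocalDatumZ.cancelS hdat (by simpa [ChainItem.check] using h1))

end Summit.NavierStokesRegularity.NavierStokesRegularity.Theorems.PoloidalWindowDoorLrcModEntireJetCertGaugeCancel

end
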